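import Summits.MatrixMultiplication.MatrixMultiplication.Theorems.AbelianSTPPCensusTwoRoomLawInt

/-!
# The three-room law in `ℤ` (TPP form; cell mm-stpp, theory g12 — eng-1 g4/g5's conjectured «3-ROOM LAW», torsion-free case)

For finite non-empty `A, B, C ⊂ ℤ` whose sum `A + B + C` is DIRECT (`|A + B + C| = |A|·|B|·|C|`, i.e. the triple
`(A, B, C)` has the triple product property in `ℤ`), the three U14⁺ rooms

  `R_A = |(A − A) + (B − C)|`, `R_B = |(B − B) + (C − A)|`, `R_C = |(C − C) + (A − B)|`

satisfy **`R_A + R_B + R_C ≥ 4·|A||B||C| − 1`** (`three_room_law_int`).  The value `4V − 1` is attained by every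
mixed-radix triple `C = [0,f)`, `B = f·[0,m)`, `A = fm·[0,g)` (rooms `V+f−1`, `V+f(m−1)`, `2V−fm`), so the constant is
sharp; this is the TPP case of conjecture G3b of `AbelianSTPPCensusTwoRoomLawInt.lean` / eng-1 g5 ROOMS-RESULT §5.2
(0 violations in ≈ 6·10⁵ tests; exact census: minimum room sum `= 4V − 1` at all 152 thin prime rows), whose `a = 1`
slice is `two_room_law_int` there.

Proof.  Room `A` is `(A + B − C) − A`, which contains the two extreme translates of the host `W₂ = A + B − C`, so
`R_A ≥ 2|W₂| − |T_{ℓ_A}(W₂)|` with `T_t(W) = {w ∈ W : w + t ∈ W}`, `ℓ_A = max A − min A`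
(`two_mul_card_le_card_sub_add_card_filter`).  KEY IDENTITY (`card_overlap_add_sub_eq`): when `A + B + C` is direct,
`|T_t(A + B − C)| = |T_t(A + B + C)|` for every `t` — both sides count pairs of points of the box `A × B × C` whose
signed sums differ by `t`, and the coordinate swap `c ↔ c'` is a bijection between the two sets of pairs (directness makes
the signed-sum maps injective on the box, so overlap elements and box pairs correspond one-to-one; also `|W₂| = V`).  Hence
all three overlap counts live on the single host `S = A + B + C` (rooms `B`, `C` use the hosts `B + C − A`, `C + A − B`,
i.e. the same statement for the rotated triples), and on one host
`|T_{ℓ_A}(S)| + |T_{ℓ_B}(S)| + |T_{ℓ_C}(S)| ≤ 2|S| + 1` is the tree's pivot lemma `card_overlap_add_card_overlap_le`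
plus super-additivity `card_overlap_add_le` (exactly as in `four_mul_card_add_add_le`).  Summing the three rooms:
`ΣR ≥ 6V − (2V + 1) = 4V − 1`.

WHAT THIS IS NOT: no statement in a finite group — the census instrument lives in `ℤ/n`, where the minimum room sum drops
below `4V − 1` through subgroups (eng-1 g5 ROOMS-RESULT §4: coset blocks, e.g. `(7,7,6)` at `ℤ/490`: `≤ 1 057 < L`); the
general (non-direct) form of G3b is NOT proved here (its cyclic two-translate bound can fail, eng-1's witness
`A={0,2,7,10}, B={1,2,4,7,9,11}, C={7}` is non-direct); no `ω` statement; no census number moves.  [original; nearest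
print Lev 1996 (J. Number Theory 58) / Gyarmati–Matolcsi–Ruzsa 2010 Thm 1.1 super-additivity, neither implies it —
mm-stpp-lit g7 LIT-INDEX rows N21–N26]
-/

-- single-conjunct summit: the mandated namespace repeats `MatrixMultiplication`.
set_option linter.dupNamespace false

namespace Summit.MatrixMultiplication.MatrixMultiplication.Theorems

namespace STPPRoomLawInt

open Finset
open scoped Pointwise

/-- The threefold sumset as the image of the box `A × B × C` under `(a,b,c) ↦ a + b + c`. [folklore] -/
theorem add_add_eq_image3 (A B C : Finset ℤ) :
    A + B + C = (A ×ˢ (B ×ˢ C)).image (fun p => p.1 + p.2.1 + p.2.2) := by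
  ext x
  simp only [mem_add, mem_image, mem_product, Prod.exists]
  constructor
  · rintro ⟨y, ⟨a, ha, b, hb, rfl⟩, c, hc, rfl⟩
    exact ⟨a, b, c, ⟨ha, hb, hc⟩, rfl⟩
  · rintro ⟨a, b, c, ⟨ha, hb, hc⟩, rfl⟩
    exact ⟨a + b, ⟨a, ha, b, hb, rfl⟩, c, hc, rfl⟩

/-- The signed sumset `A + B − C` as the image of the box under `(a,b,c) ↦ a + b − c`. [folklore] -/
theorem add_sub_eq_image3 (A B C : Finset ℤ) :
    A + B - C = (A ×ˢ (B ×ˢ C)).image (fun p => p.1 + p.2.1 - p.2.2) := by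
  ext x
  simp only [mem_sub, mem_add, mem_image, mem_product, Prod.exists]
  constructor
  · rintro ⟨y, ⟨a, ha, b, hb, rfl⟩, c, hc, rfl⟩
    exact ⟨a, b, c, ⟨ha, hb, hc⟩, rfl⟩
  · rintro ⟨a, b, c, ⟨ha, hb, hc⟩, rfl⟩
    exact ⟨a + b, ⟨a, ha, b, hb, rfl⟩, c, hc, rfl⟩

/-- Directness `|A + B + C| = |A||B||C|` means `(a,b,c) ↦ a + b + c` is injective on the box. [folklore] -/
theorem injOn_add3_of_card (A B C : Finset ℤ) (hdirect : (A + B + C).card = A.card * B.card * C.card) :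
    Set.InjOn (fun p : ℤ × (ℤ × ℤ) => p.1 + p.2.1 + p.2.2) ↑(A ×ˢ (B ×ˢ C)) := by
  rw [add_add_eq_image3] at hdirect
  apply card_image_iff.mp
  rw [hdirect, card_product, card_product, mul_assoc]

/-- If `a + b + c` is injective on the box then so is `a + b − c` (swap the two `c`-coordinates). [folklore] -/
theorem injOn_addsub3_of_injOn_add3 (A B C : Finset ℤ)
    (h : Set.InjOn (fun p : ℤ × (ℤ × ℤ) => p.1 + p.2.1 + p.2.2) ↑(A ×ˢ (B ×ˢ C))) :
    Set.InjOn (fun p : ℤ × (ℤ × ℤ) => p.1 + p.2.1 - p.2.2) ↑(A ×ˢ (B ×ˢ C)) := by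
  rintro ⟨a, b, c⟩ hx ⟨a', b', c'⟩ hy hxy
  simp only [mem_coe, mem_product] at hx hy
  simp only at hxy
  have hx' : (a, (b, c')) ∈ (A ×ˢ (B ×ˢ C)) := by simp only [mem_product]; exact ⟨hx.1, hx.2.1, hy.2.2⟩
  have hy' : (a', (b', c)) ∈ (A ×ˢ (B ×ˢ C)) := by simp only [mem_product]; exact ⟨hy.1, hy.2.1, hx.2.2⟩
  have := h (mem_coe.mpr hx') (mem_coe.mpr hy') (by simp only; linarith)
  simp only [Prod.mk.injEq] at this
  obtain ⟨rfl, rfl, rfl⟩ := this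
  rfl

/-- For a direct triple, the signed host `A + B − C` also has `|A||B||C|` elements. [folklore] -/
theorem card_add_sub_of_direct (A B C : Finset ℤ) (hdirect : (A + B + C).card = A.card * B.card * C.card) :
    (A + B - C).card = A.card * B.card * C.card := by
  rw [add_sub_eq_image3, card_image_of_injOn (injOn_addsub3_of_injOn_add3 A B C (injOn_add3_of_card A B C hdirect)),
    card_product, card_product, mul_assoc]

/-- Overlap elements versus pairs: if `f` is injective on `s` and `W = f(s)`, then the overlap set
`T_t(W) = {w ∈ W : w + t ∈ W}` is equinumerous with the pairs `(x, y) ∈ s × s` with `f y = f x + t`. [folklore] -/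
theorem card_filter_image_eq_card_pairs {α : Type*} [DecidableEq α] (s : Finset α) (f : α → ℤ)
    (hf : Set.InjOn f ↑s) (t : ℤ) :
    ((s.image f).filter (fun w => w + t ∈ s.image f)).card =
      ((s ×ˢ s).filter (fun p => f p.2 = f p.1 + t)).card := by
  symm
  refine card_bij (fun p _ => f p.1) ?_ ?_ ?_
  · intro p hp
    rw [mem_filter, mem_product] at hp
    rw [mem_filter, mem_image, mem_image]
    exact ⟨⟨p.1, hp.1.1, rfl⟩, ⟨p.2, hp.1.2, by rw [hp.2]⟩⟩
  · intro p hp q hq hpq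
    rw [mem_filter, mem_product] at hp hq
    have h1 : p.1 = q.1 := hf (mem_coe.mpr hp.1.1) (mem_coe.mpr hq.1.1) hpq
    have h2 : p.2 = q.2 := by
      apply hf (mem_coe.mpr hp.1.2) (mem_coe.mpr hq.1.2)
      rw [hp.2, hq.2, hpq]
    exact Prod.ext h1 h2
  · intro w hw
    rw [mem_filter, mem_image, mem_image] at hw
    obtain ⟨⟨x, hx, rfl⟩, y, hy, hyw⟩ := hw
    refine ⟨(x, y), ?_, rfl⟩
    rw [mem_filter, mem_product]
    exact ⟨⟨hx, hy⟩, hyw⟩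

/-- The coordinate swap `c ↔ c'` matches box pairs with `(a'+b'−c') − (a+b−c) = t` to box pairs with
`(a'+b'+c) − (a+b+c') = t`. [original] -/
theorem card_pairs_swap3 (A B C : Finset ℤ) (t : ℤ) :
    (((A ×ˢ (B ×ˢ C)) ×ˢ (A ×ˢ (B ×ˢ C))).filter
        (fun p => p.2.1 + p.2.2.1 - p.2.2.2 = (p.1.1 + p.1.2.1 - p.1.2.2) + t)).card =
      (((A ×ˢ (B ×ˢ C)) ×ˢ (A ×ˢ (B ×ˢ C))).filter
        (fun p => p.2.1 + p.2.2.1 + p.2.2.2 = (p.1.1 + p.1.2.1 + p.1.2.2) + t)).card := by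
  refine card_nbij' (fun p => ((p.1.1, (p.1.2.1, p.2.2.2)), (p.2.1, (p.2.2.1, p.1.2.2))))
    (fun p => ((p.1.1, (p.1.2.1, p.2.2.2)), (p.2.1, (p.2.2.1, p.1.2.2)))) ?_ ?_ ?_ ?_
  · rintro ⟨⟨a, b, c⟩, ⟨a', b', c'⟩⟩ hp
    simp only [mem_coe, mem_filter, mem_product] at hp ⊢
    refine ⟨⟨⟨hp.1.1.1, hp.1.1.2.1, hp.1.2.2.2⟩, hp.1.2.1, hp.1.2.2.1, hp.1.1.2.2⟩, ?_⟩
    linarith [hp.2]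
  · rintro ⟨⟨a, b, c⟩, ⟨a', b', c'⟩⟩ hp
    simp only [mem_coe, mem_filter, mem_product] at hp ⊢
    refine ⟨⟨⟨hp.1.1.1, hp.1.1.2.1, hp.1.2.2.2⟩, hp.1.2.1, hp.1.2.2.1, hp.1.1.2.2⟩, ?_⟩
    linarith [hp.2]
  · rintro ⟨⟨a, b, c⟩, ⟨a', b', c'⟩⟩ _
    rfl
  · rintro ⟨⟨a, b, c⟩, ⟨a', b', c'⟩⟩ _
    rfl

/-- **Key identity.**  For a direct triple `A + B + C ⊂ ℤ` and every `t`, the overlap count of the signed host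
`A + B − C` at shift `t` equals that of `A + B + C`: `|T_t(A + B − C)| = |T_t(A + B + C)|`.  (Both hosts are
injective images of the box, and the swap `c ↔ c'` identifies the two sets of box pairs.) [original] -/
theorem card_overlap_add_sub_eq (A B C : Finset ℤ) (hdirect : (A + B + C).card = A.card * B.card * C.card) (t : ℤ) :
    ((A + B - C).filter (fun w => w + t ∈ A + B - C)).card =
      ((A + B + C).filter (fun w => w + t ∈ A + B + C)).card := by
  have h0 := injOn_add3_of_card A B C hdirect
  have h2 := injOn_addsub3_of_injOn_add3 A B C h0
  rw [add_sub_eq_image3, add_add_eq_image3, card_filter_image_eq_card_pairs _ _ h2 t,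
    card_filter_image_eq_card_pairs _ _ h0 t]
  exact card_pairs_swap3 A B C t

/-- Bookkeeping: the room `(A − A) + (B − C)` is the host `A + B − C` minus `A`. [folklore] -/
theorem sub_add_sub_eq_host_sub {G : Type*} [AddCommGroup G] [DecidableEq G] (A B C : Finset G) :
    (A - A) + (B - C) = (A + B - C) - A := by
  simp only [sub_eq_add_neg, add_assoc, add_comm, add_left_comm]

/-- One room: for a direct triple, `2|A||B||C| ≤ |(A − A) + (B − C)| + |T_{max A − min A}(A + B + C)|`. [original] -/
theorem two_mul_le_room_add_overlap (A B C : Finset ℤ) (hA : A.Nonempty)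
    (hdirect : (A + B + C).card = A.card * B.card * C.card) :
    2 * (A.card * B.card * C.card) ≤ ((A - A) + (B - C)).card +
      ((A + B + C).filter (fun s => s + (A.max' hA - A.min' hA) ∈ A + B + C)).card := by
  have h := two_mul_card_le_card_sub_add_card_filter (A + B - C) A (min'_mem A hA) (max'_mem A hA)
  rw [card_add_sub_of_direct A B C hdirect, card_overlap_add_sub_eq A B C hdirect, ← sub_add_sub_eq_host_sub] at h
  exact h

/-- **The three-room law in `ℤ` (TPP form).**  For finite non-empty `A, B, C ⊂ ℤ` with `A + B + C` direct
(`|A + B + C| = |A|·|B|·|C|`):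
`4·|A||B||C| ≤ |(A − A) + (B − C)| + |(B − B) + (C − A)| + |(C − C) + (A − B)| + 1`.
Sharp (mixed-radix triples).  The TPP case of conjecture G3b (eng-1 g5); the `|A| = 1` slice is `two_room_law_int`.
[original] -/
theorem three_room_law_int (A B C : Finset ℤ) (hA : A.Nonempty) (hB : B.Nonempty) (hC : C.Nonempty)
    (hdirect : (A + B + C).card = A.card * B.card * C.card) :
    4 * (A.card * B.card * C.card) ≤
      ((A - A) + (B - C)).card + ((B - B) + (C - A)).card + ((C - C) + (A - B)).card + 1 := by
  classical
  have hBC : (B + C).Nonempty := hB.add hC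
  set S : Finset ℤ := A + B + C with hSdef
  have hS' : S = A + (B + C) := by rw [hSdef, add_assoc]
  set lA := A.max' hA - A.min' hA with hlA
  set lB := B.max' hB - B.min' hB with hlB
  set lC := C.max' hC - C.min' hC with hlC
  -- the rotated triples are direct too
  have hrotB : B + C + A = S := by rw [hSdef, add_comm (B + C) A, ← add_assoc]
  have hrotC : C + A + B = S := by rw [hSdef, add_comm C A, add_right_comm]
  have hdirB : (B + C + A).card = B.card * C.card * A.card := by rw [hrotB, hSdef, hdirect]; ring
  have hdirC : (C + A + B).card = C.card * A.card * B.card := by rw [hrotC, hSdef, hdirect]; ring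
  -- one inequality per room, all overlaps on the host S
  have h1 := two_mul_le_room_add_overlap A B C hA hdirect
  have h2 := two_mul_le_room_add_overlap B C A hB hdirB
  have h3 := two_mul_le_room_add_overlap C A B hC hdirC
  rw [hrotB] at h2
  rw [hrotC] at h3
  rw [← hSdef, ← hlA] at h1
  rw [← hlB] at h2
  rw [← hlC] at h3
  -- super-additivity: T_B + T_C ≤ T_{B+C} + |S|
  have h4 := card_overlap_add_le S lB lC
  -- pivot on S = A + (B + C): T_A + T_{B+C} ≤ |S| + 1
  have h5 := card_overlap_add_card_overlap_le A (B + C) hA hBC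
  have hl : (B + C).max' hBC - (B + C).min' hBC = lB + lC := max'_add_sub_min'_add B C hB hC hBC
  rw [hl, ← hS', ← hlA] at h5
  have hV : S.card = A.card * B.card * C.card := by rw [hSdef]; exact hdirect
  have e2 : B.card * C.card * A.card = A.card * B.card * C.card := by ring
  have e3 : C.card * A.card * B.card = A.card * B.card * C.card := by ring
  rw [e2] at h2
  rw [e3] at h3
  omega

/-- Excess form: with `V = |A||B||C|` and the one-dimensional floors `R_X ≥ V + |X| − 1`, the law reads
`ΣR ≥ 3V + (V − 1)`; stated here as `3V + V ≤ ΣR + 1` for convenient instantiation. [bookkeeping] -/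
theorem three_room_law_int' (A B C : Finset ℤ) (hA : A.Nonempty) (hB : B.Nonempty) (hC : C.Nonempty)
    (hdirect : (A + B + C).card = A.card * B.card * C.card) :
    3 * (A + B + C).card + (A + B + C).card ≤
      ((A - A) + (B - C)).card + ((B - B) + (C - A)).card + ((C - C) + (A - B)).card + 1 := by
  have := three_room_law_int A B C hA hB hC hdirect
  rw [hdirect]
  omega

/-- Sharpness witness (mixed radix `f = 3`, `m = 2`, `g = 2`): `C = {0,1,2}`, `B = {0,3}`, `A = {0,6}` is direct with
`V = 12` and rooms `18, 15, 14`, total `47 = 4·12 − 1`. -/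
example : (({0, 6} : Finset ℤ) + ({0, 3} : Finset ℤ) + ({0, 1, 2} : Finset ℤ)).card = 12 ∧
    ((({0, 6} : Finset ℤ) - {0, 6}) + (({0, 3} : Finset ℤ) - {0, 1, 2})).card = 18 ∧
    ((({0, 3} : Finset ℤ) - {0, 3}) + (({0, 1, 2} : Finset ℤ) - {0, 6})).card = 15 ∧
    ((({0, 1, 2} : Finset ℤ) - {0, 1, 2}) + (({0, 6} : Finset ℤ) - {0, 3})).card = 14 := by
  decide

/-! ## Append (theory g12, same session): the two-room law sees `A − B` as well — G3b when one set is a singleton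

The two rooms `(A + B) − A = B + (A − A)` and `(A + B) − B = A + (B − B)` are unchanged (up to a reflection) when `B` is
replaced by `−B`, so `three_mul_card_add_le` applied to `(A, −B)` bounds the same two cardinalities by `3|A − B| − 1`.  Hence
`|(A+B) − A| + |(A+B) − B| + 1 ≥ 3·max(|A + B|, |A − B|) ≥ 2|A + B| + |A − B|`, which is exactly conjecture G3b of
`AbelianSTPPCensusTwoRoomLawInt.lean` for `C = {c}` a singleton (there `R_C = |A − B|`, `R_A = |(A+B) − A|`, `R_B = |(A+B) − B|` and
the right-hand side is `2|A + B| + 2|A − B| − 1`).  No directness is assumed. -/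

/-- Reflecting `B` does not change the room `(A + B) − A`: `(A − B) − A = −((A + B) − A)`. [folklore] -/
theorem sub_sub_eq_neg_add_sub {G : Type*} [AddCommGroup G] [DecidableEq G] (A B : Finset G) :
    (A - B) - A = -((A + B) - A) := by
  simp only [sub_eq_add_neg, neg_add_rev, neg_neg, add_assoc, add_comm, add_left_comm]

/-- Reflecting `B` does not change the room `(A + B) − B`: `(A − B) + B = (A + B) − B`. [folklore] -/
theorem sub_add_eq_add_sub' {G : Type*} [AddCommGroup G] [DecidableEq G] (A B : Finset G) :
    (A - B) + B = (A + B) - B := by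
  simp only [sub_eq_add_neg, add_assoc, add_comm, add_left_comm]

/-- **Two-room law, max form.**  For finite non-empty `A, B ⊂ ℤ`:
`3·max(|A + B|, |A − B|) ≤ |(A + B) − A| + |(A + B) − B| + 1`. [original] -/
theorem three_mul_max_card_le (A B : Finset ℤ) (hA : A.Nonempty) (hB : B.Nonempty) :
    3 * max (A + B).card (A - B).card ≤ ((A + B) - A).card + ((A + B) - B).card + 1 := by
  classical
  have h1 := three_mul_card_add_le A B hA hB
  have h2 := three_mul_card_add_le A (-B) hA hB.neg
  rw [← sub_eq_add_neg, sub_sub_eq_neg_add_sub, card_neg, sub_neg_eq_add, sub_add_eq_add_sub'] at h2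
  rcases le_total (A + B).card (A - B).card with h | h
  · rw [max_eq_right h]; exact h2
  · rw [max_eq_left h]; exact h1

/-- **G3b with a singleton third set** (`C = {c}`; written translation-free): for finite non-empty `A, B ⊂ ℤ`,
`2|A + B| + 2|A − B| ≤ |(A + B) − A| + |(A + B) − B| + |A − B| + 1`. [original] -/
theorem g3b_singleton_form (A B : Finset ℤ) (hA : A.Nonempty) (hB : B.Nonempty) :
    2 * (A + B).card + 2 * (A - B).card ≤ ((A + B) - A).card + ((A + B) - B).card + (A - B).card + 1 := by
  have h := three_mul_max_card_le A B hA hB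
  have h1 : (A + B).card ≤ max (A + B).card (A - B).card := le_max_left _ _
  have h2 : (A - B).card ≤ max (A + B).card (A - B).card := le_max_right _ _
  omega

end STPPRoomLawInt

end Summit.MatrixMultiplication.MatrixMultiplication.Theorems
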